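import Literature.Barriers.NavierStokesRegularity.NavierStokesInequalitySwirlCalculus
import Literature.Analysis.FluidPDE.NormalisedPressureSmooth
import HarnessLib

/-!
# Calculus of the fields `u[v,f]`, III: the exact support and the planar pressure (3.21)

Barrier catalogue support file for `NavierStokesRegularity` (D-0021), on the decomposition path
of `Literature.Barriers.NavierStokesRegularity.NSIBlock_of_arrangement` (fact D of
`NavierStokesInequalityArrangement`; Ożański, arXiv:1709.00602v4, §4), continuing
`NavierStokesInequalitySwirlCalculus`. Proposition 4.2 (i) there requires `supp u(t) = G`
EXACTLY (the tree's `IsNSIBlock.tsupport_eq`), and §4 differentiates the planar pressure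
functions `p[v,f]` freely ((3.21): "`p[v,f] ∈ C^∞(ℝ²)`", since `u[v,f] ∈ C_0^∞(ℝ³)`). Proved
here for the tree's rendering:

* `revolve_closure_subset_closure_revolve`, `closure_revolve_eq` — for `U ⊆ P̄`,
  `closure (R(U)) = R(Ū)` (rotate meridian points of `U` into any given fibre);
* `IsNSIStructure.tsupport_swirlField_eq` — **`supp u[v,f] = R(Ū)`** for a structure
  (`|u[v,f]| = f > 0` on `U`, so `R(U) ⊆ {u ≠ 0}`; with `supp ⊆ R(Ū)` of part I);
* `IsNSIStructure.contDiff_normalisedPressure_swirlField` — `p*[v,f] ∈ C^∞(ℝ³)` (the tree's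
  `contDiff_normalisedPressure_of_contDiff_infty`, Ożański §3.2, applied to `u[v,f] ∈ C_c^∞`);
* `IsNSIStructure.contDiff_planePressure` — **(3.21): `p[v,f] ∈ C^∞(ℝ²)`**;
* `IsNSIStructure.contDiff_pressureInteraction` — `F[v,f] ∈ C^∞(ℝ²; ℝ²)` (Lemma 3.5 (i), first
  clause).

## References

* W. S. Ożański, arXiv:1709.00602v4, §3.3 (3.21), §3.4 (after Definition 3.3: "supported in
  `R(Ū)`"), Lemma 3.5 (i), Prop. 4.2 (i). [`Ozanski2017NSISingular`] (Held plain-text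
  rendering: "Lemma 7", "Proposition 9".)
-/

noncomputable section

open MeasureTheory Set Function Filter Topology TopologicalSpace WithLp Metric
open scoped ENNReal InnerProductSpace RealInnerProductSpace ContDiff

namespace Literature.Barriers.NavierStokesRegularity

open Literature.Analysis.FluidPDE

variable {v : ℝ × ℝ → ℝ × ℝ} {f φ : ℝ × ℝ → ℝ} {U : Set (ℝ × ℝ)}

/-! ### `closure (R(U)) = R(Ū)` -/

/-- Every point of `R(Ū)` is a limit of points of `R(U)` (for `U` in the closed half-plane):
rotate the meridian points `(rₙ, 0, zₙ)`, `(rₙ, zₙ) → R⁻¹x` in `U`, into the fibre of `x`.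
[folklore] -/
theorem revolve_closure_subset_closure_revolve {U : Set (ℝ × ℝ)} (hU : ∀ q ∈ U, 0 ≤ q.1) :
    revolve (closure U) ⊆ closure (revolve U) := by
  intro x hx
  rw [mem_revolve] at hx
  rw [mem_closure_iff_seq_limit] at hx ⊢
  obtain ⟨qn, hqn, hlim⟩ := hx
  set θ : ℝ := Complex.arg ⟨x 0, x 1⟩ with hθ
  refine ⟨fun n => rotZ θ (meridianPoint (qn n)), fun n => ?_, ?_⟩
  · rw [mem_revolve, meridian_rotZ, meridian_meridianPoint (hU _ (hqn n))]
    exact hqn n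
  · have hc : Continuous fun q : ℝ × ℝ => rotZ θ (meridianPoint q) :=
      (rotZLIE θ).continuous.comp (contDiff_meridianPoint (n := 0)).continuous
    have := (hc.tendsto (meridian x)).comp hlim
    rw [rotZ_arg_meridianPoint x] at this
    exact this

/-- **`closure (R(U)) = R(Ū)`** for `U` in the closed half-plane. [folklore] -/
theorem closure_revolve_eq {U : Set (ℝ × ℝ)} (hU : ∀ q ∈ U, 0 ≤ q.1) :
    closure (revolve U) = revolve (closure U) :=
  (closure_minimal (preimage_mono subset_closure)
      (isClosed_closure.preimage continuous_meridian)).antisymm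
    (revolve_closure_subset_closure_revolve hU)

/-! ### The exact support of `u[v,f]` -/

namespace IsNSIStructure

/-- On `R(U)` the field of a structure does not vanish (`|u[v,f]| = f > 0` there).
[cite: Ozanski2017NSISingular, §3.3 (3.11)] -/
theorem swirlField_ne_zero (h : IsNSIStructure U v f φ) {x : EuclideanSpace ℝ (Fin 3)}
    (hx : meridian x ∈ U) : swirlField v f x ≠ 0 := by
  have hq1 : 0 < (meridian x).1 := h.subset_halfPlane hx
  have hlt := h.sq_lt _ hx
  have hf : 0 < f (meridian x) := by
    have h0 : 0 ≤ (v (meridian x)).1 ^ 2 + (v (meridian x)).2 ^ 2 := by positivity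
    have := h.f_nonneg (meridian x)
    nlinarith
  intro h0
  have hn := norm_swirlField (v := v) (f := f) hq1.ne' hf.le hlt.le
  rw [h0, norm_zero] at hn
  exact hf.ne hn

/-- **`supp u[v,f] = R(Ū)`** for a structure (Ożański, after Definition 3.3, with Prop. 4.2 (i)
`supp u(t) = G`). [cite: Ozanski2017NSISingular, §3.4 (after Definition 3.3) and Prop. 4.2 (i)] -/
theorem tsupport_swirlField_eq (h : IsNSIStructure U v f φ) :
    tsupport (swirlField v f) = revolve (closure U) := by
  refine h.tsupport_swirlField_subset.antisymm ?_
  rw [← closure_revolve_eq fun q hq => (h.subset_halfPlane hq).le]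
  exact closure_mono fun x hx => Function.mem_support.2 (h.swirlField_ne_zero hx)

/-! ### (3.21): smoothness of the pressure functions of a structure -/

/-- `p*[v,f] ∈ C^∞(ℝ³)` for a structure (Ożański §3.2: "if `u ∈ C_0^∞(ℝ³)` then the
corresponding pressure function is smooth", applied to `u[v,f] ∈ C_0^∞`).
[cite: Ozanski2017NSISingular, §3.3 (3.21)] -/
theorem contDiff_normalisedPressure_swirlField (h : IsNSIStructure U v f φ) :
    ContDiff ℝ ∞ (normalisedPressure (swirlField v f)) :=
  contDiff_normalisedPressure_of_contDiff_infty h.contDiff_swirlField h.hasCompactSupport_swirlField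

/-- **(3.21): `p[v,f] ∈ C^∞(ℝ²)`** for a structure. [cite: Ozanski2017NSISingular, §3.3 (3.21)] -/
theorem contDiff_planePressure (h : IsNSIStructure U v f φ) : ContDiff ℝ ∞ (planePressure v f) :=
  h.contDiff_normalisedPressure_swirlField.comp contDiff_meridianPoint

/-- `p[0,f] ∈ C^∞(ℝ²)` for the pure swirl of a structure (`(0, f, φ)` is again a structure).
[cite: Ozanski2017NSISingular, §3.3 (3.21)] -/
theorem contDiff_planePressure_zero (h : IsNSIStructure U v f φ) :
    ContDiff ℝ ∞ (planePressure 0 f) := by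
  have h0 : IsNSIStructure U ((0 : ℝ) • v) f φ := h.smul (a := 0) (by norm_num)
  rw [zero_smul] at h0
  exact h0.contDiff_planePressure

/-- **`F[v,f] ∈ C^∞(ℝ²; ℝ²)`** for a structure (Lemma 3.5 (i), first clause: "`F ∈ C^∞(ℝ²;ℝ²)`
… follows directly from the fact that `(v,f,φ)` is a structure").
[cite: Ozanski2017NSISingular, Lemma 3.5 (i)] -/
theorem contDiff_pressureInteraction (h : IsNSIStructure U v f φ) :
    ContDiff ℝ ∞ (pressureInteraction v f) := by
  have hd : ∀ {g : ℝ × ℝ → ℝ}, ContDiff ℝ ∞ g → ∀ e : ℝ × ℝ, ContDiff ℝ ∞ fun q => fderiv ℝ g q e :=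
    fun hg e => (hg.fderiv_right (m := ∞) (by simp)).clm_apply contDiff_const
  have h0 := h.contDiff_planePressure_zero
  have h1 := h.contDiff_planePressure
  exact ((hd h0 (1, 0)).sub (hd h1 (1, 0))).prodMk ((hd h0 (0, 1)).sub (hd h1 (0, 1)))

/-- `F[v,f]` is continuous. [cite: Ozanski2017NSISingular, Lemma 3.5 (i)] -/
theorem continuous_pressureInteraction (h : IsNSIStructure U v f φ) :
    Continuous (pressureInteraction v f) :=
  h.contDiff_pressureInteraction.continuous

end IsNSIStructure

end Literature.Barriers.NavierStokesRegularity
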